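import Mathlib
import Literature.Analysis.PDE.SingleEntropy.Supersolution
import HarnessLib

/-!
# Semiconcavity in `x` of viscosity solutions of `hₜ + f(hₓ) = 0` (tripling of variables)

Topic `Literature/Analysis/PDE/SingleEntropy` — part of the formalization of
De Lellis–Otto–Westdickenberg, *Minimal entropy conditions for Burgers equation*, Quart. Appl.
Math. 62 (2004) 687–700, Thm 2.3 / Cor 2.5 (the named fact
`Literature.Analysis.PDE.deLellisOttoWestdickenberg_singleEntropy`).

For the step "viscosity solution ⇒ entropy solution" of Cor. 2.5 of the paper we use, instead of
the `BV`/Vol'pert route, the interior semiconcavity estimate for viscosity solutions with uniformly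
convex Hamiltonian (P.-L. Lions, *Generalized solutions of Hamilton–Jacobi equations*, 1982, §9;
the paper invokes it as "Corollary 9.2 of [7]" in the first step of the proof of Cor. 2.5), proved
here from scratch by the tripling-of-variables maximum principle argument:

* `abs_le_of_isLocalMax_sub` / `_isLocalMin_sub`: contact gradients of a Lipschitz function are
  bounded by the Lipschitz constant;
* `exists_barrier_profile`: the finite-speed-of-propagation barrier profile;
* `tripling_interior_contra`: the algebra showing that the three viscosity inequalities at an
  interior maximum of the tripled functional are incompatible;
* `tripling_estimate`: maximisation of the tripled functional
  `h(t,x₁)+h(s,x₂)-2h(r,x₃) - (x₁-x₂)²/(4θ(r-t_b)) - ε⁻¹(penalties) - barriers - σ(top terms)`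
  over a compact parameter box and the case analysis (interior impossible; boundary small);
* `semiconcave_of_viscosity`: `h(t,x+y)+h(t,x-y)-2h(t,x) ≤ K y²` near a point.
[folklore]
-/

noncomputable section

open MeasureTheory Set Filter Metric
open scoped Topology NNReal

namespace Literature.Analysis.PDE.SingleEntropy

/-! ## Contact gradients of Lipschitz functions are bounded -/

/-- If `k - ζ` has a local maximum at `x₁`, `k` is `Λ`-Lipschitz and `ζ` is differentiable at
`x₁`, then `|ζ'(x₁)| ≤ Λ` (one-sided difference quotients). [folklore] -/
theorem abs_le_of_isLocalMax_sub {k ζ : ℝ → ℝ} {Λ x₁ d : ℝ}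
    (hk : ∀ x x', |k x - k x'| ≤ Λ * |x - x'|) (hζ : HasDerivAt ζ d x₁)
    (hmax : IsLocalMax (fun x => k x - ζ x) x₁) : |d| ≤ Λ := by
  have hlow : ∀ᶠ x in 𝓝 x₁, -(Λ * |x - x₁|) ≤ ζ x - ζ x₁ := by
    filter_upwards [hmax] with x hx
    have := (abs_le.mp (hk x x₁)).1
    have hx' : k x - ζ x ≤ k x₁ - ζ x₁ := hx
    linarith
  obtain ⟨hL, hR⟩ := hasDerivAt_iff_tendsto_slope_left_right.mp hζ
  have h1 : -Λ ≤ d := by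
    refine ge_of_tendsto hR ?_
    have h' : ∀ᶠ x in 𝓝[>] x₁, -(Λ * |x - x₁|) ≤ ζ x - ζ x₁ := nhdsWithin_le_nhds hlow
    filter_upwards [h', self_mem_nhdsWithin] with x hx hgt
    have hpos : 0 < x - x₁ := sub_pos.mpr hgt
    rw [slope_def_field, le_div_iff₀ hpos]
    rw [abs_of_pos hpos] at hx
    linarith
  have h2 : d ≤ Λ := by
    refine le_of_tendsto hL ?_
    have h' : ∀ᶠ x in 𝓝[<] x₁, -(Λ * |x - x₁|) ≤ ζ x - ζ x₁ := nhdsWithin_le_nhds hlow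
    filter_upwards [h', self_mem_nhdsWithin] with x hx hlt
    have hneg : x - x₁ < 0 := sub_neg.mpr hlt
    rw [slope_def_field, div_le_iff_of_neg hneg]
    rw [abs_of_neg hneg] at hx
    linarith
  exact abs_le.mpr ⟨h1, h2⟩

/-- If `k - ζ` has a local minimum at `x₁`, `k` is `Λ`-Lipschitz and `ζ` is differentiable at
`x₁`, then `|ζ'(x₁)| ≤ Λ`. [folklore] -/
theorem abs_le_of_isLocalMin_sub {k ζ : ℝ → ℝ} {Λ x₁ d : ℝ}
    (hk : ∀ x x', |k x - k x'| ≤ Λ * |x - x'|) (hζ : HasDerivAt ζ d x₁)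
    (hmin : IsLocalMin (fun x => k x - ζ x) x₁) : |d| ≤ Λ := by
  have hmax : IsLocalMax (fun x => (-k x) - (-ζ x)) x₁ := by
    filter_upwards [hmin] with x hx
    have hx' : k x₁ - ζ x₁ ≤ k x - ζ x := hx
    show -k x - -ζ x ≤ -k x₁ - -ζ x₁
    linarith
  have := abs_le_of_isLocalMax_sub (k := fun x => -k x) (fun x x' => by
    rw [show -k x - -k x' = -(k x - k x') by ring, abs_neg]; exact hk x x') hζ.neg hmax
  rwa [abs_neg] at this


/-! ## The finite-speed barrier profile -/

/-- Barrier profile `g(s) = H·S(2s/R)` (`S` = `Real.smoothTransition`): smooth, nondecreasing,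
`0` on `s ≤ 0`, `H` on `s ≥ R/2`, with bounded derivative. [folklore] -/
theorem exists_barrier_profile {H R : ℝ} (hH : 0 ≤ H) (hR : 0 < R) :
    ∃ g : ℝ → ℝ, ContDiff ℝ (⊤ : ℕ∞) g ∧ (∀ s, s ≤ 0 → g s = 0) ∧ (∀ s, R / 2 ≤ s → g s = H) ∧
      (∀ s, 0 ≤ g s) ∧ (∀ s, g s ≤ H) ∧ (∀ s, 0 ≤ deriv g s) ∧
      ∃ Γ, 0 ≤ Γ ∧ ∀ s, deriv g s ≤ Γ := by
  obtain ⟨hS1, hS2, hS3, C, hC0, hSC⟩ := smoothTransition_deriv_props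
  have hd : ∀ s, HasDerivAt (fun s => H * Real.smoothTransition (2 * s / R))
      (H * (deriv Real.smoothTransition (2 * s / R) * (2 / R))) s := by
    intro s
    have ha : HasDerivAt (fun s => 2 * s / R) (2 / R) s := by
      have := ((hasDerivAt_id s).const_mul 2).div_const R
      simpa using this
    have hSd : HasDerivAt Real.smoothTransition (deriv Real.smoothTransition (2 * s / R))
        (2 * s / R) :=
      ((Real.smoothTransition.contDiff (n := 1)).differentiable one_ne_zero _).hasDerivAt
    exact (hSd.comp s ha).const_mul H
  refine ⟨fun s => H * Real.smoothTransition (2 * s / R), ?_, ?_, ?_, ?_, ?_, ?_, ?_⟩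
  · exact contDiff_const.mul (Real.smoothTransition.contDiff.comp (by fun_prop))
  · intro s hs
    have : 2 * s / R ≤ 0 := div_nonpos_of_nonpos_of_nonneg (by linarith) hR.le
    simp [Real.smoothTransition.zero_of_nonpos this]
  · intro s hs
    have : 1 ≤ 2 * s / R := by rw [le_div_iff₀ hR]; linarith
    simp [Real.smoothTransition.one_of_one_le this]
  · intro s; exact mul_nonneg hH (Real.smoothTransition.nonneg _)
  · intro s; exact mul_le_of_le_one_right hH (Real.smoothTransition.le_one _)
  · intro s
    rw [(hd s).deriv]
    exact mul_nonneg hH (mul_nonneg (hS1 _) (by positivity))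
  · refine ⟨H * (C * (2 / R)), by positivity, fun s => ?_⟩
    rw [(hd s).deriv]
    exact mul_le_mul_of_nonneg_left (mul_le_mul_of_nonneg_right (hSC _) (by positivity)) hH

/-! ## The algebra of the interior case -/

/-- **Interior case of the tripling argument.** The three viscosity inequalities at an interior
maximum of the tripled functional are incompatible: with `P` the semiconcavity-modulus slope,
`e` the penalisation slope, `gᵢ`/`Gtᵢ` the space/time derivatives of the barrier at the three
points (`Gtᵢ ≥ L' |gᵢ|`, finite speed of propagation), `σᵢ > 0` the top-barrier slopes, uniform
convexity `f(e+P) + f(e-P) ≥ 2 f(e) + θ P²` and `L' ≥ Lip(f)`, the inequalities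
`α + Gt₁ + σ₁ + f(P+e+g₁) ≤ 0`, `β + Gt₂ + σ₂ + f(-P+e+g₂) ≤ 0`,
`0 ≤ θP²/2 + (α+β)/2 - Gt₃ - σ₃ + f(e-g₃)` cannot all hold. [folklore] -/
theorem tripling_interior_contra {f : ℝ → ℝ} {θ Λ Γ Lf L' : ℝ}
    {α β P e g₁ g₂ g₃ Gt₁ Gt₂ Gt₃ σ₁ σ₂ σ₃ : ℝ}
    (hconv : ∀ e P, 2 * f e + θ * P ^ 2 ≤ f (e + P) + f (e - P))
    (hfL : ∀ p p', |p| ≤ Λ + Γ → |p'| ≤ Λ + Γ → |f p - f p'| ≤ Lf * |p - p'|)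
    (hL' : Lf ≤ L') (hc1 : |P + e + g₁| ≤ Λ) (hc2 : |-P + e + g₂| ≤ Λ) (hc3 : |e - g₃| ≤ Λ)
    (hg₁ : |g₁| ≤ Γ) (hg₂ : |g₂| ≤ Γ) (hg₃ : |g₃| ≤ Γ)
    (hG₁ : L' * |g₁| ≤ Gt₁) (hG₂ : L' * |g₂| ≤ Gt₂) (hG₃ : L' * |g₃| ≤ Gt₃)
    (hσ₁ : 0 ≤ σ₁) (hσ₂ : 0 ≤ σ₂) (hσ₃ : 0 < σ₃)
    (h1 : α + Gt₁ + σ₁ + f (P + e + g₁) ≤ 0) (h2 : β + Gt₂ + σ₂ + f (-P + e + g₂) ≤ 0)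
    (h3 : 0 ≤ θ * P ^ 2 / 2 + (α + β) / 2 - Gt₃ - σ₃ + f (e - g₃)) : False := by
  -- Lipschitz comparisons
  have hPe : |P + e| ≤ Λ + Γ := by
    have : P + e = (P + e + g₁) - g₁ := by ring
    rw [this]; exact (abs_sub _ _).trans (by linarith)
  have hmPe : |e - P| ≤ Λ + Γ := by
    have : e - P = (-P + e + g₂) - g₂ := by ring
    rw [this]; exact (abs_sub _ _).trans (by linarith)
  have he : |e| ≤ Λ + Γ := by
    have : e = (e - g₃) + g₃ := by ring
    rw [this]; exact (abs_add_le _ _).trans (by linarith)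
  have hΓ0 : 0 ≤ Γ := (abs_nonneg _).trans hg₁
  have l1 : f (e + P) - f (P + e + g₁) ≤ Lf * |g₁| := by
    have := hfL (e + P) (P + e + g₁) (by rwa [add_comm] at hPe) (hc1.trans (by linarith))
    rw [show e + P - (P + e + g₁) = -g₁ by ring, abs_neg] at this
    exact (le_abs_self _).trans this
  have l2 : f (e - P) - f (-P + e + g₂) ≤ Lf * |g₂| := by
    have := hfL (e - P) (-P + e + g₂) hmPe (hc2.trans (by linarith))
    rw [show e - P - (-P + e + g₂) = -g₂ by ring, abs_neg] at this
    exact (le_abs_self _).trans this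
  have l3 : f (e - g₃) - f e ≤ Lf * |g₃| := by
    have := hfL (e - g₃) e (hc3.trans (by linarith)) he
    rw [show e - g₃ - e = -g₃ by ring, abs_neg] at this
    exact (le_abs_self _).trans this
  have hcv := hconv e P
  have t1 : Lf * |g₁| ≤ L' * |g₁| := mul_le_mul_of_nonneg_right hL' (abs_nonneg _)
  have t2 : Lf * |g₂| ≤ L' * |g₂| := mul_le_mul_of_nonneg_right hL' (abs_nonneg _)
  have t3 : Lf * |g₃| ≤ L' * |g₃| := mul_le_mul_of_nonneg_right hL' (abs_nonneg _)
  linarith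

/-- `Λ d - d²/c ≤ Λ² c / 4` for `c > 0`. [folklore] -/
theorem penalty_bound {Λ d c : ℝ} (hc : 0 < c) : Λ * d - d ^ 2 / c ≤ Λ ^ 2 * c / 4 := by
  have h1 : Λ * d = (Λ * c) * (d / c) := by field_simp
  have h2 : d ^ 2 / c = (d / c) ^ 2 * c := by field_simp
  rw [h1, h2]
  nlinarith [mul_nonneg hc.le (sq_nonneg (d / c - Λ / 2))]

/-- `|a| + |b| ≤ |a - b| + |a + b|`. [folklore] -/
theorem abs_add_abs_le_abs_sub_add_abs_add (a b : ℝ) : |a| + |b| ≤ |a - b| + |a + b| := by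
  rcases le_total 0 a with ha | ha <;> rcases le_total 0 b with hb | hb <;>
    rcases le_total 0 (a - b) with h1 | h1 <;> rcases le_total 0 (a + b) with h2 | h2 <;>
    simp only [abs_of_nonneg, abs_of_nonpos, *] <;> linarith


/-! ## The tripling-of-variables estimate -/

set_option maxHeartbeats 1600000 in
-- one long proof: maximisation of the tripled functional and the case analysis
/-- **Tripling of variables.** Let `h` be continuous, `Λ`-Lipschitz in each variable, a viscosity
sub- and supersolution of `hₜ + f(hₓ) = 0` on `V ⊇ [t_b, t_e] × [x_c - R, x_c + R]` (test functions
`C¹` at the point), with `f` uniformly convex (`f(e+P) + f(e-P) ≥ 2f(e) + θP²`) and Lipschitz on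
the relevant range of slopes, and let `g` be a barrier profile. If `L'(t_e - t_b) ≤ R/4` (finite
speed of propagation) then for the parameters `ε, σ, κ, κ_σ` of the tripled functional
`Φ = h(t,x₁) + h(s,x₂) - 2h(r,x₃) - (x₁-x₂)²/(4θ(r-t_b)) - ε⁻¹[(t-r)² + (s-r)² + (x₁+x₂-2x₃)²]
 - G(t,x₁) - G(s,x₂) - 2G(r,x₃) - σ[(t_e-t)⁻¹ + (t_e-s)⁻¹ + 2(t_e-r)⁻¹]`
its value at a diagonal point is at most `3Λ²ε/4 + Λ²θκ`: at an interior maximum the three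
viscosity inequalities contradict each other (`tripling_interior_contra`), and on the boundary of
the parameter box the functional is small. [folklore] -/
theorem tripling_estimate {h : ℝ × ℝ → ℝ} {f g : ℝ → ℝ}
    {Λ θ Γ Lf L' Hsup R xc t_b t_e : ℝ}
    (hcont : Continuous h) (hLipx : ∀ t x x', |h (t, x) - h (t, x')| ≤ Λ * |x - x'|)
    (hLipt : ∀ t t' x, |h (t, x) - h (t', x)| ≤ Λ * |t - t'|) (hΛ : 0 ≤ Λ) (hθ : 0 < θ)
    (hconv : ∀ e P, 2 * f e + θ * P ^ 2 ≤ f (e + P) + f (e - P))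
    (hfL : ∀ p p', |p| ≤ Λ + Γ → |p'| ≤ Λ + Γ → |f p - f p'| ≤ Lf * |p - p'|)
    (hL' : Lf ≤ L') (hL'0 : 0 < L')
    {V : Set (ℝ × ℝ)}
    (hsub : ∀ z ∈ V, ∀ ζ : ℝ × ℝ → ℝ, ContDiffAt ℝ 1 ζ z → IsLocalMax (fun y => h y - ζ y) z →
      fderiv ℝ ζ z (1, 0) + f (fderiv ℝ ζ z (0, 1)) ≤ 0)
    (hsup : ∀ z ∈ V, ∀ ζ : ℝ × ℝ → ℝ, ContDiffAt ℝ 1 ζ z → IsLocalMin (fun y => h y - ζ y) z →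
      0 ≤ fderiv ℝ ζ z (1, 0) + f (fderiv ℝ ζ z (0, 1)))
    (hR : 0 < R) (hbox : Icc t_b t_e ×ˢ Icc (xc - R) (xc + R) ⊆ V)
    (hHsup : ∀ t ∈ Icc t_b t_e, ∀ x ∈ Icc (xc - R) (xc + R), |h (t, x)| ≤ Hsup)
    (hHsup0 : 0 ≤ Hsup) (hgs : ContDiff ℝ (⊤ : ℕ∞) g) (hg0 : ∀ s, s ≤ 0 → g s = 0)
    (hgH : ∀ s, R / 2 ≤ s → g s = 8 * Hsup + 1) (hgnn : ∀ s, 0 ≤ g s)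
    (hg'nn : ∀ s, 0 ≤ deriv g s) (hg'Γ : ∀ s, deriv g s ≤ Γ)
    (hspeed : L' * (t_e - t_b) ≤ R / 4)
    {ε σ κ κσ : ℝ} (hε : 0 < ε) (hσ : 0 < σ) (hκ : 0 < κ) (hκσ : 0 < κσ)
    (hκσ' : κσ * (4 * Hsup + 1) ≤ σ) (hεκ : ε * (4 * Hsup + 2) ≤ κ ^ 2)
    {th xh yh : ℝ} (hth1 : t_b + κ ≤ th) (hth2 : th ≤ t_e - κσ)
    (hxy : |xh - xc| + |yh| ≤ R / 4) :
    h (th, xh + yh) + h (th, xh - yh) - 2 * h (th, xh) - yh ^ 2 / (θ * (th - t_b))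
      - 4 * σ / (t_e - th) ≤ 3 * Λ ^ 2 * ε / 4 + Λ ^ 2 * θ * κ := by
  have hΓ0 : 0 ≤ Γ := (hg'nn 0).trans (hg'Γ 0)
  have hgd : Differentiable ℝ g := hgs.differentiable (by simp)
  ----------------------------------------------------------------
  -- the barrier `G τ ξ = g(a₁) + g(a₂)`
  ----------------------------------------------------------------
  obtain ⟨G, hG⟩ : ∃ G : ℝ → ℝ → ℝ, G = fun τ ξ =>
      g (ξ - xc - R / 2 + L' * (τ - t_b)) + g (-(ξ - xc) - R / 2 + L' * (τ - t_b)) := ⟨_, rfl⟩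
  have hGnn : ∀ τ ξ, 0 ≤ G τ ξ := fun τ ξ => by rw [hG]; exact add_nonneg (hgnn _) (hgnn _)
  have hGbig : ∀ τ ξ, t_b ≤ τ → R ≤ |ξ - xc| → 8 * Hsup + 1 ≤ G τ ξ := by
    intro τ ξ hτ hξ
    rw [hG]
    have hL : 0 ≤ L' * (τ - t_b) := mul_nonneg hL'0.le (by linarith)
    rcases le_abs.mp hξ with h1 | h1
    · have : R / 2 ≤ ξ - xc - R / 2 + L' * (τ - t_b) := by linarith
      dsimp only; rw [hgH _ this]; linarith [hgnn (-(ξ - xc) - R / 2 + L' * (τ - t_b))]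
    · have : R / 2 ≤ -(ξ - xc) - R / 2 + L' * (τ - t_b) := by linarith
      dsimp only; rw [hgH _ this]; linarith [hgnn (ξ - xc - R / 2 + L' * (τ - t_b))]
  have hGzero : ∀ τ ξ, τ ≤ t_e → |ξ - xc| ≤ R / 4 → G τ ξ = 0 := by
    intro τ ξ hτ hξ
    rw [hG]
    have hL : L' * (τ - t_b) ≤ R / 4 := by
      have := mul_le_mul_of_nonneg_left (show τ - t_b ≤ t_e - t_b by linarith) hL'0.le
      linarith
    have h1 := abs_le.mp hξ
    dsimp only
    rw [hg0 _ (by linarith), hg0 _ (by linarith), add_zero]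
  -- slice derivatives of `G`
  have hGt : ∀ τ ξ, HasDerivAt (fun τ' => G τ' ξ)
      (deriv g (ξ - xc - R / 2 + L' * (τ - t_b)) * L'
        + deriv g (-(ξ - xc) - R / 2 + L' * (τ - t_b)) * L') τ := by
    intro τ ξ
    rw [hG]
    have ha1 : HasDerivAt (fun τ' => ξ - xc - R / 2 + L' * (τ' - t_b)) L' τ := by
      have := ((hasDerivAt_id τ).sub_const t_b).const_mul L' |>.const_add (ξ - xc - R / 2)
      simpa using this
    have ha2 : HasDerivAt (fun τ' => -(ξ - xc) - R / 2 + L' * (τ' - t_b)) L' τ := by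
      have := ((hasDerivAt_id τ).sub_const t_b).const_mul L' |>.const_add (-(ξ - xc) - R / 2)
      simpa using this
    exact ((hgd _).hasDerivAt.comp τ ha1).add ((hgd _).hasDerivAt.comp τ ha2)
  have hGx : ∀ τ ξ, HasDerivAt (fun ξ' => G τ ξ')
      (deriv g (ξ - xc - R / 2 + L' * (τ - t_b)) * 1
        + deriv g (-(ξ - xc) - R / 2 + L' * (τ - t_b)) * (-1)) ξ := by
    intro τ ξ
    rw [hG]
    have ha1 : HasDerivAt (fun ξ' => ξ' - xc - R / 2 + L' * (τ - t_b)) 1 ξ := by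
      have := (((hasDerivAt_id ξ).sub_const xc).sub_const (R / 2)).add_const (L' * (τ - t_b))
      simpa using this
    have ha2 : HasDerivAt (fun ξ' => -(ξ' - xc) - R / 2 + L' * (τ - t_b)) (-1) ξ := by
      have := ((((hasDerivAt_id ξ).sub_const xc).neg).sub_const (R / 2)).add_const (L' * (τ - t_b))
      simpa using this
    exact ((hgd _).hasDerivAt.comp ξ ha1).add ((hgd _).hasDerivAt.comp ξ ha2)
  -- `G` as a smooth function on the plane
  have hG2 : ContDiff ℝ (⊤ : ℕ∞) (fun z : ℝ × ℝ => G z.1 z.2) := by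
    rw [hG]
    exact (hgs.comp (by fun_prop)).add (hgs.comp (by fun_prop))
  ----------------------------------------------------------------
  -- the tripled functional on the compact parameter box
  ----------------------------------------------------------------
  obtain ⟨Φ, hΦ⟩ : ∃ Φ : ℝ → ℝ → ℝ → ℝ → ℝ → ℝ → ℝ, Φ = fun t s r x₁ x₂ x₃ =>
      h (t, x₁) + h (s, x₂) - 2 * h (r, x₃) - (x₁ - x₂) ^ 2 / (4 * θ * (r - t_b))
      - ε⁻¹ * ((t - r) ^ 2 + (s - r) ^ 2 + (x₁ + x₂ - 2 * x₃) ^ 2)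
      - G t x₁ - G s x₂ - 2 * G r x₃
      - σ * ((t_e - t)⁻¹ + (t_e - s)⁻¹ + 2 * (t_e - r)⁻¹) := ⟨_, rfl⟩
  set D : Set (ℝ × ℝ × ℝ × ℝ × ℝ × ℝ) :=
    Icc t_b (t_e - κσ) ×ˢ (Icc t_b (t_e - κσ) ×ˢ (Icc (t_b + κ) (t_e - κσ) ×ˢ
      (Icc (xc - R) (xc + R) ×ˢ (Icc (xc - R) (xc + R) ×ˢ Icc (xc - R) (xc + R))))) with hD
  have hDc : IsCompact D := by
    simp only [hD]
    apply_rules [IsCompact.prod, isCompact_Icc]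
  set Φ6 : ℝ × ℝ × ℝ × ℝ × ℝ × ℝ → ℝ :=
    fun P => Φ P.1 P.2.1 P.2.2.1 P.2.2.2.1 P.2.2.2.2.1 P.2.2.2.2.2 with hΦ6
  -- continuity on `D`
  have hΦc : ContinuousOn Φ6 D := by
    have key : ∀ P ∈ D, t_b < P.2.2.1 ∧ P.1 < t_e ∧ P.2.1 < t_e ∧ P.2.2.1 < t_e := by
      intro P hP
      simp only [hD, mem_prod, mem_Icc] at hP
      refine ⟨by linarith [hP.2.2.1.1], by linarith [hP.1.2], by linarith [hP.2.1.2],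
        by linarith [hP.2.2.1.2]⟩
    simp only [hΦ6, hΦ]
    apply ContinuousOn.sub
    · apply ContinuousOn.sub; apply ContinuousOn.sub; apply ContinuousOn.sub; apply ContinuousOn.sub
      · apply ContinuousOn.sub
        · exact Continuous.continuousOn (by fun_prop)
        · apply ContinuousOn.div (Continuous.continuousOn (by fun_prop))
            (Continuous.continuousOn (by fun_prop))
          intro P hP; have := (key P hP).1; positivity
      · exact Continuous.continuousOn (by fun_prop)
      · exact (hG2.continuous.comp (by fun_prop : Continuous fun P : ℝ × ℝ × ℝ × ℝ × ℝ × ℝ =>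
          (P.1, P.2.2.2.1))).continuousOn
      · exact (hG2.continuous.comp (by fun_prop : Continuous fun P : ℝ × ℝ × ℝ × ℝ × ℝ × ℝ =>
          (P.2.1, P.2.2.2.2.1))).continuousOn
      · exact (continuous_const.mul (hG2.continuous.comp (by fun_prop :
          Continuous fun P : ℝ × ℝ × ℝ × ℝ × ℝ × ℝ => (P.2.2.1, P.2.2.2.2.2)))).continuousOn
    · apply ContinuousOn.mul continuousOn_const
      apply ContinuousOn.add; apply ContinuousOn.add
      · apply ContinuousOn.inv₀ (Continuous.continuousOn (by fun_prop))
        intro P hP; have := (key P hP).2.1; exact ne_of_gt (by linarith)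
      · apply ContinuousOn.inv₀ (Continuous.continuousOn (by fun_prop))
        intro P hP; have := (key P hP).2.2.1; exact ne_of_gt (by linarith)
      · apply ContinuousOn.mul continuousOn_const
        apply ContinuousOn.inv₀ (Continuous.continuousOn (by fun_prop))
        intro P hP; have := (key P hP).2.2.2; exact ne_of_gt (by linarith)
  ----------------------------------------------------------------
  -- the diagonal point and the maximiser
  ----------------------------------------------------------------
  have hxhR : |xh - xc| ≤ R / 4 := by linarith [abs_nonneg yh]
  have hyR : |yh| ≤ R / 4 := by linarith [abs_nonneg (xh - xc)]
  have habs1 : |xh + yh - xc| ≤ R / 4 := by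
    calc |xh + yh - xc| = |(xh - xc) + yh| := by ring_nf
      _ ≤ |xh - xc| + |yh| := abs_add_le _ _
      _ ≤ R / 4 := hxy
  have habs2 : |xh - yh - xc| ≤ R / 4 := by
    calc |xh - yh - xc| = |(xh - xc) - yh| := by ring_nf
      _ ≤ |xh - xc| + |yh| := abs_sub _ _
      _ ≤ R / 4 := hxy
  have hd1 : xh + yh ∈ Icc (xc - R) (xc + R) := by
    have := abs_le.mp habs1; exact ⟨by linarith, by linarith⟩
  have hd2 : xh - yh ∈ Icc (xc - R) (xc + R) := by
    have := abs_le.mp habs2; exact ⟨by linarith, by linarith⟩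
  have hd3 : xh ∈ Icc (xc - R) (xc + R) := by
    have := abs_le.mp hxhR; exact ⟨by linarith, by linarith⟩
  have hthI : th ∈ Icc t_b (t_e - κσ) := ⟨by linarith, hth2⟩
  have hthI' : th ∈ Icc (t_b + κ) (t_e - κσ) := ⟨hth1, hth2⟩
  have hdD : ((th, th, th, xh + yh, xh - yh, xh) : ℝ × ℝ × ℝ × ℝ × ℝ × ℝ) ∈ D := by
    simp only [hD, mem_prod]; exact ⟨hthI, hthI, hthI', hd1, hd2, hd3⟩
  have hth3 : th < t_e := by linarith
  have hth4 : t_b < th := by linarith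
  have hΦd : Φ6 (th, th, th, xh + yh, xh - yh, xh) = h (th, xh + yh) + h (th, xh - yh)
      - 2 * h (th, xh) - yh ^ 2 / (θ * (th - t_b)) - 4 * σ / (t_e - th) := by
    simp only [hΦ6, hΦ]
    rw [hGzero th (xh + yh) hth3.le habs1, hGzero th (xh - yh) hth3.le habs2,
      hGzero th xh hth3.le hxhR]
    have h1 : th - t_b ≠ 0 := by linarith
    have h2 : t_e - th ≠ 0 := by linarith
    field_simp
    ring
  obtain ⟨Pm, hPmD, hmax⟩ := hDc.exists_isMaxOn ⟨_, hdD⟩ hΦc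
  have hmax' : ∀ P ∈ D, Φ6 P ≤ Φ6 Pm := fun P hP => hmax hP
  suffices hsuff : Φ6 Pm ≤ 3 * Λ ^ 2 * ε / 4 + Λ ^ 2 * θ * κ by
    rw [← hΦd]; exact (hmax' _ hdD).trans hsuff
  obtain ⟨t, s, r, x₁, x₂, x₃⟩ := Pm
  have hPmD' := hPmD
  simp only [hD, mem_prod, mem_Icc] at hPmD'
  obtain ⟨⟨ht1, ht2⟩, ⟨hs1, hs2⟩, ⟨hr1, hr2⟩, ⟨hx11, hx12⟩, ⟨hx21, hx22⟩, ⟨hx31, hx32⟩⟩ := hPmD'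
  ----------------------------------------------------------------
  -- general facts at the maximiser
  ----------------------------------------------------------------
  have hh1 : |h (t, x₁)| ≤ Hsup := hHsup t ⟨ht1, by linarith⟩ x₁ ⟨hx11, hx12⟩
  have hh2 : |h (s, x₂)| ≤ Hsup := hHsup s ⟨hs1, by linarith⟩ x₂ ⟨hx21, hx22⟩
  have hh3 : |h (r, x₃)| ≤ Hsup := hHsup r ⟨by linarith, by linarith⟩ x₃ ⟨hx31, hx32⟩
  have hsum : h (t, x₁) + h (s, x₂) - 2 * h (r, x₃) ≤ 4 * Hsup := by
    have a1 := (abs_le.mp hh1).2; have a2 := (abs_le.mp hh2).2; have a3 := (abs_le.mp hh3).1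
    linarith
  have hrtb : 0 < r - t_b := by linarith
  have htet : 0 < t_e - t := by linarith
  have htes : 0 < t_e - s := by linarith
  have hter : 0 < t_e - r := by linarith
  -- the penalty pieces
  obtain ⟨Q, hQ⟩ : ∃ Q : ℝ, Q = (x₁ - x₂) ^ 2 / (4 * θ * (r - t_b)) := ⟨_, rfl⟩
  obtain ⟨Pε, hPε⟩ : ∃ Pε : ℝ, Pε = ε⁻¹ * ((t - r) ^ 2 + (s - r) ^ 2 + (x₁ + x₂ - 2 * x₃) ^ 2) :=
    ⟨_, rfl⟩
  obtain ⟨Gs, hGs⟩ : ∃ Gs : ℝ, Gs = G t x₁ + G s x₂ + 2 * G r x₃ := ⟨_, rfl⟩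
  obtain ⟨Sσ, hSσ⟩ : ∃ Sσ : ℝ, Sσ = σ * ((t_e - t)⁻¹ + (t_e - s)⁻¹ + 2 * (t_e - r)⁻¹) := ⟨_, rfl⟩
  have hval : Φ6 (t, s, r, x₁, x₂, x₃) = h (t, x₁) + h (s, x₂) - 2 * h (r, x₃) - Q - Pε - Gs - Sσ := by
    simp only [hΦ6, hΦ, hQ, hPε, hGs, hSσ]; ring
  have hQnn : 0 ≤ Q := by rw [hQ]; positivity
  have hPεnn : 0 ≤ Pε := by rw [hPε]; positivity
  have hGsnn : 0 ≤ Gs := by rw [hGs]; linarith [hGnn t x₁, hGnn s x₂, hGnn r x₃]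
  have hi1 : 0 ≤ (t_e - t)⁻¹ := inv_nonneg.mpr htet.le
  have hi2 : 0 ≤ (t_e - s)⁻¹ := inv_nonneg.mpr htes.le
  have hi3 : 0 ≤ (t_e - r)⁻¹ := inv_nonneg.mpr hter.le
  have hSσnn : 0 ≤ Sσ := by rw [hSσ]; positivity
  have hbound0 : (0 : ℝ) ≤ 3 * Λ ^ 2 * ε / 4 + Λ ^ 2 * θ * κ := by positivity
  ----------------------------------------------------------------
  -- Case 1: a lateral face
  ----------------------------------------------------------------
  by_cases hlat : R ≤ |x₁ - xc| ∨ R ≤ |x₂ - xc| ∨ R ≤ |x₃ - xc|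
  · have hbig : 8 * Hsup + 1 ≤ Gs := by
      rw [hGs]
      rcases hlat with h1 | h1 | h1
      · linarith [hGbig t x₁ ht1 h1, hGnn s x₂, hGnn r x₃]
      · linarith [hGbig s x₂ hs1 h1, hGnn t x₁, hGnn r x₃]
      · linarith [hGbig r x₃ (by linarith) h1, hGnn t x₁, hGnn s x₂]
    rw [hval]; linarith only [hsum, hbig, hQnn, hPεnn, hSσnn, hbound0, hHsup0]
  push Not at hlat
  obtain ⟨hxa1, hxa2, hxa3⟩ := hlat
  ----------------------------------------------------------------
  -- Case 2: a top face
  ----------------------------------------------------------------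
  have hσκ : 4 * Hsup + 1 ≤ σ * κσ⁻¹ := by
    rw [← div_eq_mul_inv, le_div_iff₀ hκσ]; linarith
  by_cases htop : t = t_e - κσ ∨ s = t_e - κσ ∨ r = t_e - κσ
  · have hbig : 4 * Hsup + 1 ≤ Sσ := by
      rw [hSσ]
      have ex : σ * ((t_e - t)⁻¹ + (t_e - s)⁻¹ + 2 * (t_e - r)⁻¹)
          = σ * (t_e - t)⁻¹ + σ * (t_e - s)⁻¹ + 2 * (σ * (t_e - r)⁻¹) := by ring
      rw [ex]
      have m1 := mul_nonneg hσ.le hi1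
      have m2 := mul_nonneg hσ.le hi2
      have m3 := mul_nonneg hσ.le hi3
      rcases htop with h1 | h1 | h1
      · have e : t_e - t = κσ := by linarith
        rw [e] at m1 ⊢; linarith only [hσκ, m2, m3]
      · have e : t_e - s = κσ := by linarith
        rw [e] at m2 ⊢; linarith only [hσκ, m1, m3]
      · have e : t_e - r = κσ := by linarith
        rw [e] at m3 ⊢; linarith only [hσκ, m1, m2, hHsup0]
    rw [hval]; linarith only [hsum, hbig, hQnn, hPεnn, hGsnn, hbound0]
  push Not at htop
  obtain ⟨htne, hsne, hrne⟩ := htop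
  have ht2' : t < t_e - κσ := lt_of_le_of_ne ht2 htne
  have hs2' : s < t_e - κσ := lt_of_le_of_ne hs2 hsne
  have hr2' : r < t_e - κσ := lt_of_le_of_ne hr2 hrne
  ----------------------------------------------------------------
  -- Case 3: the bottom face in `r`
  ----------------------------------------------------------------
  by_cases hrb : r = t_b + κ
  · have hrk : r - t_b = κ := by linarith
    have d1 : h (t, x₁) - h (r, x₃) ≤ Λ * |t - r| + Λ * |x₁ - x₃| := by
      have a := (abs_le.mp (hLipt t r x₁)).2
      have b := (abs_le.mp (hLipx r x₁ x₃)).2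
      linarith
    have d2 : h (s, x₂) - h (r, x₃) ≤ Λ * |s - r| + Λ * |x₂ - x₃| := by
      have a := (abs_le.mp (hLipt s r x₂)).2
      have b := (abs_le.mp (hLipx r x₂ x₃)).2
      linarith
    have d3 : |x₁ - x₃| + |x₂ - x₃| ≤ |x₁ - x₂| + |x₁ + x₂ - 2 * x₃| := by
      have := abs_add_abs_le_abs_sub_add_abs_add (x₁ - x₃) (x₂ - x₃)
      have e1 : x₁ - x₃ - (x₂ - x₃) = x₁ - x₂ := by ring
      have e2 : x₁ - x₃ + (x₂ - x₃) = x₁ + x₂ - 2 * x₃ := by ring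
      rwa [e1, e2] at this
    have p1 : Λ * |t - r| - |t - r| ^ 2 / ε ≤ Λ ^ 2 * ε / 4 := penalty_bound hε
    have p2 : Λ * |s - r| - |s - r| ^ 2 / ε ≤ Λ ^ 2 * ε / 4 := penalty_bound hε
    have p3 : Λ * |x₁ + x₂ - 2 * x₃| - |x₁ + x₂ - 2 * x₃| ^ 2 / ε ≤ Λ ^ 2 * ε / 4 :=
      penalty_bound hε
    have p4 : Λ * |x₁ - x₂| - |x₁ - x₂| ^ 2 / (4 * θ * κ) ≤ Λ ^ 2 * (4 * θ * κ) / 4 :=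
      penalty_bound (by positivity)
    rw [sq_abs] at p1 p2 p3 p4
    have eQ : Q = (x₁ - x₂) ^ 2 / (4 * θ * κ) := by rw [hQ, hrk]
    have eP : Pε = (t - r) ^ 2 / ε + (s - r) ^ 2 / ε + (x₁ + x₂ - 2 * x₃) ^ 2 / ε := by
      rw [hPε]; field_simp
    rw [hval, eQ, eP]
    have d3' := mul_le_mul_of_nonneg_left d3 hΛ
    have e4 : Λ ^ 2 * (4 * θ * κ) / 4 = Λ ^ 2 * θ * κ := by ring
    linarith only [d1, d2, d3', p1, p2, p3, p4, hGsnn, hSσnn, e4]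
  have hr1' : t_b + κ < r := lt_of_le_of_ne hr1 (Ne.symm hrb)
  ----------------------------------------------------------------
  -- Case 4: a bottom face in `t` or `s`
  ----------------------------------------------------------------
  have hκε : 4 * Hsup + 2 ≤ κ ^ 2 / ε := by
    rw [le_div_iff₀ hε]; linarith
  by_cases htb : t = t_b ∨ s = t_b
  · have hbig : 4 * Hsup + 2 ≤ Pε := by
      rw [hPε]
      rcases htb with h1 | h1
      · have hk : κ ^ 2 ≤ (t - r) ^ 2 := by
          have h' : κ ≤ r - t := by linarith only [h1, hr1]
          calc κ ^ 2 ≤ (r - t) ^ 2 := pow_le_pow_left₀ hκ.le h' 2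
            _ = (t - r) ^ 2 := by ring
        have : κ ^ 2 / ε ≤ ε⁻¹ * ((t - r) ^ 2 + (s - r) ^ 2 + (x₁ + x₂ - 2 * x₃) ^ 2) := by
          rw [div_eq_mul_inv, mul_comm]
          apply mul_le_mul_of_nonneg_left _ (inv_nonneg.mpr hε.le)
          linarith only [hk, sq_nonneg (s - r), sq_nonneg (x₁ + x₂ - 2 * x₃)]
        linarith only [hκε, this]
      · have hk : κ ^ 2 ≤ (s - r) ^ 2 := by
          have h' : κ ≤ r - s := by linarith only [h1, hr1]
          calc κ ^ 2 ≤ (r - s) ^ 2 := pow_le_pow_left₀ hκ.le h' 2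
            _ = (s - r) ^ 2 := by ring
        have : κ ^ 2 / ε ≤ ε⁻¹ * ((t - r) ^ 2 + (s - r) ^ 2 + (x₁ + x₂ - 2 * x₃) ^ 2) := by
          rw [div_eq_mul_inv, mul_comm]
          apply mul_le_mul_of_nonneg_left _ (inv_nonneg.mpr hε.le)
          linarith only [hk, sq_nonneg (t - r), sq_nonneg (x₁ + x₂ - 2 * x₃)]
        linarith only [hκε, this]
    rw [hval]; linarith only [hsum, hbig, hQnn, hGsnn, hSσnn, hbound0]
  push Not at htb
  obtain ⟨htne', hsne'⟩ := htb
  have ht1' : t_b < t := lt_of_le_of_ne ht1 (Ne.symm htne')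
  have hs1' : t_b < s := lt_of_le_of_ne hs1 (Ne.symm hsne')
  ----------------------------------------------------------------
  -- Case 5: an interior maximum is impossible
  ----------------------------------------------------------------
  exfalso
  have hL'nn : 0 ≤ L' := hL'0.le
  -- smoothness helpers
  have cInv : ∀ z₀ : ℝ × ℝ, z₀.1 < t_e → ContDiffAt ℝ 1 (fun z : ℝ × ℝ => (t_e - z.1)⁻¹) z₀ :=
    fun z₀ hz₀ => (contDiffAt_const.sub contDiffAt_fst).inv (by
      show t_e - z₀.1 ≠ 0
      exact sub_ne_zero.mpr (ne_of_gt hz₀))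
  have cInv' : ∀ z₀ : ℝ × ℝ, t_b < z₀.1 →
      ContDiffAt ℝ 1 (fun z : ℝ × ℝ => (4 * θ * (z.1 - t_b))⁻¹) z₀ :=
    fun z₀ hz₀ => (contDiffAt_const.mul (contDiffAt_fst.sub contDiffAt_const)).inv (by
      show 4 * θ * (z₀.1 - t_b) ≠ 0
      exact mul_ne_zero (by positivity) (sub_ne_zero.mpr (ne_of_gt hz₀)))
  have cG : ∀ z₀ : ℝ × ℝ, ContDiffAt ℝ 1 (fun z : ℝ × ℝ => G z.1 z.2) z₀ := fun z₀ =>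
    (hG2.of_le (by simp)).contDiffAt
  -- values of the barrier derivatives at the three points
  obtain ⟨gt₁, hgt₁⟩ : ∃ v : ℝ, v = deriv g (x₁ - xc - R / 2 + L' * (t - t_b)) := ⟨_, rfl⟩
  obtain ⟨gt₁', hgt₁'⟩ : ∃ v : ℝ, v = deriv g (-(x₁ - xc) - R / 2 + L' * (t - t_b)) := ⟨_, rfl⟩
  obtain ⟨gt₂, hgt₂⟩ : ∃ v : ℝ, v = deriv g (x₂ - xc - R / 2 + L' * (s - t_b)) := ⟨_, rfl⟩
  obtain ⟨gt₂', hgt₂'⟩ : ∃ v : ℝ, v = deriv g (-(x₂ - xc) - R / 2 + L' * (s - t_b)) := ⟨_, rfl⟩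
  obtain ⟨gt₃, hgt₃⟩ : ∃ v : ℝ, v = deriv g (x₃ - xc - R / 2 + L' * (r - t_b)) := ⟨_, rfl⟩
  obtain ⟨gt₃', hgt₃'⟩ : ∃ v : ℝ, v = deriv g (-(x₃ - xc) - R / 2 + L' * (r - t_b)) := ⟨_, rfl⟩
  have bg : ∀ {v a : ℝ}, v = deriv g a → 0 ≤ v ∧ v ≤ Γ := fun hv => by
    rw [hv]; exact ⟨hg'nn _, hg'Γ _⟩
  obtain ⟨b1, b1'⟩ := bg hgt₁; obtain ⟨b2, b2'⟩ := bg hgt₁'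
  obtain ⟨b3, b3'⟩ := bg hgt₂; obtain ⟨b4, b4'⟩ := bg hgt₂'
  obtain ⟨b5, b5'⟩ := bg hgt₃; obtain ⟨b6, b6'⟩ := bg hgt₃'
  -- the slopes entering `tripling_interior_contra`
  obtain ⟨α, hα⟩ : ∃ v : ℝ, v = 2 * ε⁻¹ * (t - r) := ⟨_, rfl⟩
  obtain ⟨β, hβ⟩ : ∃ v : ℝ, v = 2 * ε⁻¹ * (s - r) := ⟨_, rfl⟩
  obtain ⟨P, hP⟩ : ∃ v : ℝ, v = (x₁ - x₂) / (2 * θ * (r - t_b)) := ⟨_, rfl⟩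
  obtain ⟨e, he⟩ : ∃ v : ℝ, v = 2 * ε⁻¹ * (x₁ + x₂ - 2 * x₃) := ⟨_, rfl⟩
  ----------------------------------------------------------------
  -- Test function 1 at `(t, x₁)` (subsolution)
  ----------------------------------------------------------------
  obtain ⟨ζ₁, hζ₁⟩ : ∃ ζ₁ : ℝ × ℝ → ℝ, ζ₁ = fun z =>
      -h (s, x₂) + 2 * h (r, x₃) + (z.2 - x₂) ^ 2 / (4 * θ * (r - t_b))
      + ε⁻¹ * ((z.1 - r) ^ 2 + (s - r) ^ 2 + (z.2 + x₂ - 2 * x₃) ^ 2)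
      + G z.1 z.2 + G s x₂ + 2 * G r x₃
      + σ * ((t_e - z.1)⁻¹ + (t_e - s)⁻¹ + 2 * (t_e - r)⁻¹) := ⟨_, rfl⟩
  have hid₁ : ∀ z : ℝ × ℝ, h z - ζ₁ z = Φ6 (z.1, s, r, z.2, x₂, x₃) := by
    intro z
    simp only [hζ₁, hΦ6, hΦ]
    ring
  have hmax₁ : IsLocalMax (fun y => h y - ζ₁ y) (t, x₁) := by
    have hN : Icc t_b (t_e - κσ) ×ˢ Icc (xc - R) (xc + R) ∈ 𝓝 ((t, x₁) : ℝ × ℝ) :=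
      prod_mem_nhds (Icc_mem_nhds ht1' ht2')
        (Icc_mem_nhds (by linarith [(abs_lt.mp hxa1).1]) (by linarith [(abs_lt.mp hxa1).2]))
    refine Filter.eventually_of_mem hN fun y hy => ?_
    obtain ⟨hy1, hy2⟩ := mem_prod.mp hy
    show h y - ζ₁ y ≤ h (t, x₁) - ζ₁ (t, x₁)
    rw [hid₁ y, hid₁ (t, x₁)]
    apply hmax'
    simp only [hD, mem_prod]
    exact ⟨hy1, ⟨hs1, hs2⟩, ⟨hr1, hr2⟩, hy2, ⟨hx21, hx22⟩, ⟨hx31, hx32⟩⟩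
  have hcd₁ : ContDiffAt ℝ 1 ζ₁ (t, x₁) := by
    rw [hζ₁]
    refine ((((((contDiffAt_const.add ?_).add ?_).add (cG _)).add contDiffAt_const).add
      contDiffAt_const).add ?_)
    · exact (((contDiffAt_snd.sub contDiffAt_const).pow 2).div_const _)
    · exact contDiffAt_const.mul ((((contDiffAt_fst.sub contDiffAt_const).pow 2).add
        contDiffAt_const).add ((contDiffAt_snd.add contDiffAt_const).sub contDiffAt_const |>.pow 2))
    · exact contDiffAt_const.mul (((cInv _ (by show t < t_e; linarith)).add contDiffAt_const).add
        contDiffAt_const)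
  -- slice derivatives
  have hdt₁ : HasDerivAt (fun τ => ζ₁ (τ, x₁))
      (α + (gt₁ * L' + gt₁' * L') + σ / (t_e - t) ^ 2) t := by
    rw [hζ₁]; simp only
    have d1 : HasDerivAt (fun τ : ℝ => ε⁻¹ * ((τ - r) ^ 2 + (s - r) ^ 2 + (x₁ + x₂ - 2 * x₃) ^ 2))
        (ε⁻¹ * (2 * (t - r) ^ 1 * 1 + 0 + 0)) t :=
      ((((hasDerivAt_id t).sub_const r).pow 2).add (hasDerivAt_const _ _) |>.add
        (hasDerivAt_const _ _)).const_mul _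
    have d2 := hGt t x₁
    rw [← hgt₁, ← hgt₁'] at d2
    have d3 : HasDerivAt (fun τ : ℝ => σ * ((t_e - τ)⁻¹ + (t_e - s)⁻¹ + 2 * (t_e - r)⁻¹))
        (σ * (-(-1) / (t_e - t) ^ 2 + 0 + 0)) t := by
      have := (((hasDerivAt_id t).const_sub t_e).inv (by linarith : t_e - t ≠ 0)).add
        (hasDerivAt_const t ((t_e - s)⁻¹)) |>.add (hasDerivAt_const t (2 * (t_e - r)⁻¹))
      exact this.const_mul σ
    have := ((((((hasDerivAt_const t (-h (s, x₂))).add (hasDerivAt_const t (2 * h (r, x₃)))).add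
      (hasDerivAt_const t ((x₁ - x₂) ^ 2 / (4 * θ * (r - t_b))))).add d1).add d2).add
      (hasDerivAt_const t (G s x₂))).add (hasDerivAt_const t (2 * G r x₃)) |>.add d3
    refine this.congr_deriv ?_
    rw [hα]; field_simp; ring
  have hdx₁ : HasDerivAt (fun ξ => ζ₁ (t, ξ)) (P + e + (gt₁ - gt₁')) x₁ := by
    rw [hζ₁]; simp only
    have d1 : HasDerivAt (fun ξ : ℝ => (ξ - x₂) ^ 2 / (4 * θ * (r - t_b)))
        (2 * (x₁ - x₂) ^ 1 * 1 / (4 * θ * (r - t_b))) x₁ :=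
      (((hasDerivAt_id x₁).sub_const x₂).pow 2).div_const _
    have d2 : HasDerivAt (fun ξ : ℝ => ε⁻¹ * ((t - r) ^ 2 + (s - r) ^ 2 + (ξ + x₂ - 2 * x₃) ^ 2))
        (ε⁻¹ * (0 + 0 + 2 * (x₁ + x₂ - 2 * x₃) ^ 1 * 1)) x₁ :=
      (((hasDerivAt_const _ _).add (hasDerivAt_const _ _)).add
        ((((hasDerivAt_id x₁).add_const x₂).sub_const (2 * x₃)).pow 2)).const_mul _
    have d3 := hGx t x₁
    rw [← hgt₁, ← hgt₁'] at d3
    have := ((((((hasDerivAt_const x₁ (-h (s, x₂))).add (hasDerivAt_const x₁ (2 * h (r, x₃)))).add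
      d1).add d2).add d3).add (hasDerivAt_const x₁ (G s x₂))).add
      (hasDerivAt_const x₁ (2 * G r x₃)) |>.add
      (hasDerivAt_const x₁ (σ * ((t_e - t)⁻¹ + (t_e - s)⁻¹ + 2 * (t_e - r)⁻¹)))
    refine this.congr_deriv ?_
    rw [hP, he]; field_simp; ring
  have hfd₁ : fderiv ℝ ζ₁ (t, x₁) (1, 0) = α + (gt₁ * L' + gt₁' * L') + σ / (t_e - t) ^ 2 := by
    rw [← hdt₁.deriv]; exact (deriv_slice_fst (hcd₁.differentiableAt (by simp))).symm
  have hfd₁' : fderiv ℝ ζ₁ (t, x₁) (0, 1) = P + e + (gt₁ - gt₁') := by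
    rw [← hdx₁.deriv]; exact (deriv_slice_snd (hcd₁.differentiableAt (by simp))).symm
  have hc₁ : |P + e + (gt₁ - gt₁')| ≤ Λ := by
    refine abs_le_of_isLocalMax_sub (k := fun ξ => h (t, ξ)) (hLipx t) hdx₁ ?_
    have hc : Continuous fun ξ : ℝ => ((t, ξ) : ℝ × ℝ) := by fun_prop
    exact (hc.tendsto x₁).eventually hmax₁
  have ineq₁ := hsub (t, x₁) (hbox (mem_prod.mpr ⟨⟨ht1, by linarith⟩, ⟨hx11, hx12⟩⟩)) ζ₁ hcd₁ hmax₁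
  rw [hfd₁, hfd₁'] at ineq₁
  ----------------------------------------------------------------
  -- Test function 2 at `(s, x₂)` (subsolution)
  ----------------------------------------------------------------
  obtain ⟨ζ₂, hζ₂⟩ : ∃ ζ₂ : ℝ × ℝ → ℝ, ζ₂ = fun z =>
      -h (t, x₁) + 2 * h (r, x₃) + (x₁ - z.2) ^ 2 / (4 * θ * (r - t_b))
      + ε⁻¹ * ((t - r) ^ 2 + (z.1 - r) ^ 2 + (x₁ + z.2 - 2 * x₃) ^ 2)
      + G t x₁ + G z.1 z.2 + 2 * G r x₃
      + σ * ((t_e - t)⁻¹ + (t_e - z.1)⁻¹ + 2 * (t_e - r)⁻¹) := ⟨_, rfl⟩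
  have hid₂ : ∀ z : ℝ × ℝ, h z - ζ₂ z = Φ6 (t, z.1, r, x₁, z.2, x₃) := by
    intro z
    simp only [hζ₂, hΦ6, hΦ]
    ring
  have hmax₂ : IsLocalMax (fun y => h y - ζ₂ y) (s, x₂) := by
    have hN : Icc t_b (t_e - κσ) ×ˢ Icc (xc - R) (xc + R) ∈ 𝓝 ((s, x₂) : ℝ × ℝ) :=
      prod_mem_nhds (Icc_mem_nhds hs1' hs2')
        (Icc_mem_nhds (by linarith [(abs_lt.mp hxa2).1]) (by linarith [(abs_lt.mp hxa2).2]))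
    refine Filter.eventually_of_mem hN fun y hy => ?_
    obtain ⟨hy1, hy2⟩ := mem_prod.mp hy
    show h y - ζ₂ y ≤ h (s, x₂) - ζ₂ (s, x₂)
    rw [hid₂ y, hid₂ (s, x₂)]
    apply hmax'
    simp only [hD, mem_prod]
    exact ⟨⟨ht1, ht2⟩, hy1, ⟨hr1, hr2⟩, ⟨hx11, hx12⟩, hy2, ⟨hx31, hx32⟩⟩
  have hcd₂ : ContDiffAt ℝ 1 ζ₂ (s, x₂) := by
    rw [hζ₂]
    refine ((((((contDiffAt_const.add ?_).add ?_).add contDiffAt_const).add (cG _)).add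
      contDiffAt_const).add ?_)
    · exact (((contDiffAt_const.sub contDiffAt_snd).pow 2).div_const _)
    · exact contDiffAt_const.mul (((contDiffAt_const.add ((contDiffAt_fst.sub contDiffAt_const).pow
        2))).add ((contDiffAt_const.add contDiffAt_snd).sub contDiffAt_const |>.pow 2))
    · exact contDiffAt_const.mul ((contDiffAt_const.add (cInv _ (by show s < t_e; linarith))).add
        contDiffAt_const)
  have hdt₂ : HasDerivAt (fun τ => ζ₂ (τ, x₂))
      (β + (gt₂ * L' + gt₂' * L') + σ / (t_e - s) ^ 2) s := by
    rw [hζ₂]; simp only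
    have d1 : HasDerivAt (fun τ : ℝ => ε⁻¹ * ((t - r) ^ 2 + (τ - r) ^ 2 + (x₁ + x₂ - 2 * x₃) ^ 2))
        (ε⁻¹ * (0 + 2 * (s - r) ^ 1 * 1 + 0)) s :=
      (((hasDerivAt_const _ _).add (((hasDerivAt_id s).sub_const r).pow 2)).add
        (hasDerivAt_const _ _)).const_mul _
    have d2 := hGt s x₂
    rw [← hgt₂, ← hgt₂'] at d2
    have d3 : HasDerivAt (fun τ : ℝ => σ * ((t_e - t)⁻¹ + (t_e - τ)⁻¹ + 2 * (t_e - r)⁻¹))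
        (σ * (0 + -(-1) / (t_e - s) ^ 2 + 0)) s := by
      have := ((hasDerivAt_const s ((t_e - t)⁻¹)).add
        (((hasDerivAt_id s).const_sub t_e).inv (by linarith : t_e - s ≠ 0))) |>.add
        (hasDerivAt_const s (2 * (t_e - r)⁻¹))
      exact this.const_mul σ
    have := ((((((hasDerivAt_const s (-h (t, x₁))).add (hasDerivAt_const s (2 * h (r, x₃)))).add
      (hasDerivAt_const s ((x₁ - x₂) ^ 2 / (4 * θ * (r - t_b))))).add d1).add
      (hasDerivAt_const s (G t x₁))).add d2).add (hasDerivAt_const s (2 * G r x₃)) |>.add d3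
    refine this.congr_deriv ?_
    rw [hβ]; field_simp; ring
  have hdx₂ : HasDerivAt (fun ξ => ζ₂ (s, ξ)) (-P + e + (gt₂ - gt₂')) x₂ := by
    rw [hζ₂]; simp only
    have d1 : HasDerivAt (fun ξ : ℝ => (x₁ - ξ) ^ 2 / (4 * θ * (r - t_b)))
        (2 * (x₁ - x₂) ^ 1 * (-1) / (4 * θ * (r - t_b))) x₂ :=
      (((hasDerivAt_id x₂).const_sub x₁).pow 2).div_const _
    have d2 : HasDerivAt (fun ξ : ℝ => ε⁻¹ * ((t - r) ^ 2 + (s - r) ^ 2 + (x₁ + ξ - 2 * x₃) ^ 2))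
        (ε⁻¹ * (0 + 0 + 2 * (x₁ + x₂ - 2 * x₃) ^ 1 * 1)) x₂ :=
      (((hasDerivAt_const _ _).add (hasDerivAt_const _ _)).add
        ((((hasDerivAt_id x₂).const_add x₁).sub_const (2 * x₃)).pow 2)).const_mul _
    have d3 := hGx s x₂
    rw [← hgt₂, ← hgt₂'] at d3
    have := ((((((hasDerivAt_const x₂ (-h (t, x₁))).add (hasDerivAt_const x₂ (2 * h (r, x₃)))).add
      d1).add d2).add (hasDerivAt_const x₂ (G t x₁))).add d3).add
      (hasDerivAt_const x₂ (2 * G r x₃)) |>.add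
      (hasDerivAt_const x₂ (σ * ((t_e - t)⁻¹ + (t_e - s)⁻¹ + 2 * (t_e - r)⁻¹)))
    refine this.congr_deriv ?_
    rw [hP, he]; field_simp; ring
  have hfd₂ : fderiv ℝ ζ₂ (s, x₂) (1, 0) = β + (gt₂ * L' + gt₂' * L') + σ / (t_e - s) ^ 2 := by
    rw [← hdt₂.deriv]; exact (deriv_slice_fst (hcd₂.differentiableAt (by simp))).symm
  have hfd₂' : fderiv ℝ ζ₂ (s, x₂) (0, 1) = -P + e + (gt₂ - gt₂') := by
    rw [← hdx₂.deriv]; exact (deriv_slice_snd (hcd₂.differentiableAt (by simp))).symm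
  have hc₂ : |-P + e + (gt₂ - gt₂')| ≤ Λ := by
    refine abs_le_of_isLocalMax_sub (k := fun ξ => h (s, ξ)) (hLipx s) hdx₂ ?_
    have hc : Continuous fun ξ : ℝ => ((s, ξ) : ℝ × ℝ) := by fun_prop
    exact (hc.tendsto x₂).eventually hmax₂
  have ineq₂ := hsub (s, x₂) (hbox (mem_prod.mpr ⟨⟨hs1, by linarith⟩, ⟨hx21, hx22⟩⟩)) ζ₂ hcd₂ hmax₂
  rw [hfd₂, hfd₂'] at ineq₂
  ----------------------------------------------------------------
  -- Test function 3 at `(r, x₃)` (supersolution)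
  ----------------------------------------------------------------
  obtain ⟨ζ₃, hζ₃⟩ : ∃ ζ₃ : ℝ × ℝ → ℝ, ζ₃ = fun z =>
      2⁻¹ * (h (t, x₁) + h (s, x₂) - (x₁ - x₂) ^ 2 * (4 * θ * (z.1 - t_b))⁻¹
      - ε⁻¹ * ((t - z.1) ^ 2 + (s - z.1) ^ 2 + (x₁ + x₂ - 2 * z.2) ^ 2)
      - G t x₁ - G s x₂ - 2 * G z.1 z.2
      - σ * ((t_e - t)⁻¹ + (t_e - s)⁻¹ + 2 * (t_e - z.1)⁻¹)) := ⟨_, rfl⟩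
  have hid₃ : ∀ z : ℝ × ℝ, t_b < z.1 → h z - ζ₃ z = -2⁻¹ * Φ6 (t, s, z.1, x₁, x₂, z.2) := by
    intro z hz
    simp only [hζ₃, hΦ6, hΦ]
    have : 4 * θ * (z.1 - t_b) ≠ 0 := mul_ne_zero (by positivity) (sub_ne_zero.mpr (ne_of_gt hz))
    field_simp
    ring
  have hmin₃ : IsLocalMin (fun y => h y - ζ₃ y) (r, x₃) := by
    have hN : Icc (t_b + κ) (t_e - κσ) ×ˢ Icc (xc - R) (xc + R) ∈ 𝓝 ((r, x₃) : ℝ × ℝ) :=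
      prod_mem_nhds (Icc_mem_nhds hr1' hr2')
        (Icc_mem_nhds (by linarith [(abs_lt.mp hxa3).1]) (by linarith [(abs_lt.mp hxa3).2]))
    refine Filter.eventually_of_mem hN fun y hy => ?_
    obtain ⟨hy1, hy2⟩ := mem_prod.mp hy
    show h (r, x₃) - ζ₃ (r, x₃) ≤ h y - ζ₃ y
    rw [hid₃ y (by linarith [hy1.1]), hid₃ (r, x₃) (by show t_b < r; linarith)]
    have := hmax' (t, s, y.1, x₁, x₂, y.2) (by
      simp only [hD, mem_prod]
      exact ⟨⟨ht1, ht2⟩, ⟨hs1, hs2⟩, hy1, ⟨hx11, hx12⟩, ⟨hx21, hx22⟩, hy2⟩)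
    simp only at this ⊢
    linarith
  have hcd₃ : ContDiffAt ℝ 1 ζ₃ (r, x₃) := by
    rw [hζ₃]
    refine contDiffAt_const.mul ((((((contDiffAt_const.sub ?_).sub ?_).sub contDiffAt_const).sub
      contDiffAt_const).sub (contDiffAt_const.mul (cG _))).sub ?_)
    · exact contDiffAt_const.mul (cInv' _ (by show t_b < r; linarith))
    · exact contDiffAt_const.mul ((((contDiffAt_const.sub contDiffAt_fst).pow 2).add
        ((contDiffAt_const.sub contDiffAt_fst).pow 2)).add
        ((contDiffAt_const.sub (contDiffAt_const.mul contDiffAt_snd)).pow 2))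
    · exact contDiffAt_const.mul ((contDiffAt_const.add contDiffAt_const).add
        (contDiffAt_const.mul (cInv _ (by show r < t_e; linarith))))
  have hdt₃ : HasDerivAt (fun ρ => ζ₃ (ρ, x₃))
      (θ * P ^ 2 / 2 + (α + β) / 2 - (gt₃ * L' + gt₃' * L') - σ / (t_e - r) ^ 2) r := by
    rw [hζ₃]; simp only
    have hrtb' : 4 * θ * (r - t_b) ≠ 0 := by positivity
    have d1 : HasDerivAt (fun ρ : ℝ => (x₁ - x₂) ^ 2 * (4 * θ * (ρ - t_b))⁻¹)
        ((x₁ - x₂) ^ 2 * (-(4 * θ * 1) / (4 * θ * (r - t_b)) ^ 2)) r := by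
      have hc : HasDerivAt (fun ρ : ℝ => 4 * θ * (ρ - t_b)) (4 * θ * 1) r :=
        ((hasDerivAt_id r).sub_const t_b).const_mul _
      exact (hc.inv hrtb').const_mul _
    have d2 : HasDerivAt (fun ρ : ℝ => ε⁻¹ * ((t - ρ) ^ 2 + (s - ρ) ^ 2 + (x₁ + x₂ - 2 * x₃) ^ 2))
        (ε⁻¹ * (2 * (t - r) ^ 1 * (-1) + 2 * (s - r) ^ 1 * (-1) + 0)) r :=
      (((((hasDerivAt_id r).const_sub t).pow 2).add (((hasDerivAt_id r).const_sub s).pow 2)).add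
        (hasDerivAt_const _ _)).const_mul _
    have d3 := (hGt r x₃).const_mul 2
    rw [← hgt₃, ← hgt₃'] at d3
    have d4 : HasDerivAt (fun ρ : ℝ => σ * ((t_e - t)⁻¹ + (t_e - s)⁻¹ + 2 * (t_e - ρ)⁻¹))
        (σ * (0 + 0 + 2 * (-(-1) / (t_e - r) ^ 2))) r := by
      have := ((hasDerivAt_const r ((t_e - t)⁻¹)).add (hasDerivAt_const r ((t_e - s)⁻¹))).add
        ((((hasDerivAt_id r).const_sub t_e).inv (by linarith : t_e - r ≠ 0)).const_mul 2)
      exact this.const_mul σ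
    have := ((((((hasDerivAt_const r (h (t, x₁))).add (hasDerivAt_const r (h (s, x₂)))).sub d1).sub
      d2).sub (hasDerivAt_const r (G t x₁))).sub (hasDerivAt_const r (G s x₂))).sub d3 |>.sub d4
      |>.const_mul (2⁻¹ : ℝ)
    refine this.congr_deriv ?_
    rw [hP, hα, hβ]; field_simp; ring
  have hdx₃ : HasDerivAt (fun ξ => ζ₃ (r, ξ)) (e - (gt₃ - gt₃')) x₃ := by
    rw [hζ₃]; simp only
    have d2 : HasDerivAt (fun ξ : ℝ => ε⁻¹ * ((t - r) ^ 2 + (s - r) ^ 2 + (x₁ + x₂ - 2 * ξ) ^ 2))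
        (ε⁻¹ * (0 + 0 + 2 * (x₁ + x₂ - 2 * x₃) ^ 1 * (-(2 * 1)))) x₃ :=
      (((hasDerivAt_const _ _).add (hasDerivAt_const _ _)).add
        ((((hasDerivAt_id x₃).const_mul 2).const_sub (x₁ + x₂)).pow 2)).const_mul _
    have d3 := (hGx r x₃).const_mul 2
    rw [← hgt₃, ← hgt₃'] at d3
    have := ((((((hasDerivAt_const x₃ (h (t, x₁))).add (hasDerivAt_const x₃ (h (s, x₂)))).sub
      (hasDerivAt_const x₃ ((x₁ - x₂) ^ 2 * (4 * θ * (r - t_b))⁻¹))).sub d2).sub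
      (hasDerivAt_const x₃ (G t x₁))).sub (hasDerivAt_const x₃ (G s x₂))).sub d3 |>.sub
      (hasDerivAt_const x₃ (σ * ((t_e - t)⁻¹ + (t_e - s)⁻¹ + 2 * (t_e - r)⁻¹)))
      |>.const_mul (2⁻¹ : ℝ)
    refine this.congr_deriv ?_
    rw [he]; field_simp; ring
  have hfd₃ : fderiv ℝ ζ₃ (r, x₃) (1, 0)
      = θ * P ^ 2 / 2 + (α + β) / 2 - (gt₃ * L' + gt₃' * L') - σ / (t_e - r) ^ 2 := by
    rw [← hdt₃.deriv]; exact (deriv_slice_fst (hcd₃.differentiableAt (by simp))).symm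
  have hfd₃' : fderiv ℝ ζ₃ (r, x₃) (0, 1) = e - (gt₃ - gt₃') := by
    rw [← hdx₃.deriv]; exact (deriv_slice_snd (hcd₃.differentiableAt (by simp))).symm
  have hc₃ : |e - (gt₃ - gt₃')| ≤ Λ := by
    refine abs_le_of_isLocalMin_sub (k := fun ξ => h (r, ξ)) (hLipx r) hdx₃ ?_
    have hc : Continuous fun ξ : ℝ => ((r, ξ) : ℝ × ℝ) := by fun_prop
    exact (hc.tendsto x₃).eventually hmin₃
  have ineq₃ := hsup (r, x₃) (hbox (mem_prod.mpr ⟨⟨by linarith, by linarith⟩, ⟨hx31, hx32⟩⟩))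
    ζ₃ hcd₃ hmin₃
  rw [hfd₃, hfd₃'] at ineq₃
  ----------------------------------------------------------------
  -- the contradiction
  ----------------------------------------------------------------
  have hσ₃ : 0 < σ / (t_e - r) ^ 2 := by positivity
  refine tripling_interior_contra (θ := θ) (Λ := Λ) (Γ := Γ) (Lf := Lf) (L' := L')
    (α := α) (β := β) (P := P) (e := e) (g₁ := gt₁ - gt₁') (g₂ := gt₂ - gt₂') (g₃ := gt₃ - gt₃')
    (Gt₁ := gt₁ * L' + gt₁' * L') (Gt₂ := gt₂ * L' + gt₂' * L') (Gt₃ := gt₃ * L' + gt₃' * L')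
    (σ₁ := σ / (t_e - t) ^ 2) (σ₂ := σ / (t_e - s) ^ 2) (σ₃ := σ / (t_e - r) ^ 2)
    hconv hfL hL' hc₁ hc₂ hc₃ ?_ ?_ ?_ ?_ ?_ ?_ (by positivity) (by positivity) hσ₃
    (by linarith only [ineq₁]) (by linarith only [ineq₂]) (by linarith only [ineq₃])
  · rw [abs_le]; constructor <;> linarith only [b1, b1', b2, b2']
  · rw [abs_le]; constructor <;> linarith only [b3, b3', b4, b4']
  · rw [abs_le]; constructor <;> linarith only [b5, b5', b6, b6']
  · have h0 : |gt₁ - gt₁'| ≤ gt₁ + gt₁' := by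
      rw [abs_le]; constructor <;> linarith only [b1, b2]
    have h1 := mul_le_mul_of_nonneg_left h0 hL'nn
    have e1 : L' * (gt₁ + gt₁') = gt₁ * L' + gt₁' * L' := by ring
    linarith only [h1, e1]
  · have h0 : |gt₂ - gt₂'| ≤ gt₂ + gt₂' := by
      rw [abs_le]; constructor <;> linarith only [b3, b4]
    have h1 := mul_le_mul_of_nonneg_left h0 hL'nn
    have e1 : L' * (gt₂ + gt₂') = gt₂ * L' + gt₂' * L' := by ring
    linarith only [h1, e1]
  · have h0 : |gt₃ - gt₃'| ≤ gt₃ + gt₃' := by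
      rw [abs_le]; constructor <;> linarith only [b5, b6]
    have h1 := mul_le_mul_of_nonneg_left h0 hL'nn
    have e1 : L' * (gt₃ + gt₃') = gt₃ * L' + gt₃' * L' := by ring
    linarith only [h1, e1]


/-! ## Local semiconcavity of viscosity solutions -/

/-- **Viscosity solutions of `hₜ + f(hₓ) = 0` with uniformly convex `f` are semiconcave in `x`,
locally.** If `h` is continuous and `Λ`-Lipschitz in each variable, a viscosity sub- and
supersolution on an open set containing the closed box `[t_c - ρ₀, t_c + ρ₀] × [x_c - ρ₀, x_c + ρ₀]`
(test functions `C¹` at the point), and `f` is continuous, locally Lipschitz and uniformly convex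
(`f(e+P) + f(e-P) ≥ 2f(e) + θP²`), then near `(t_c, x_c)`:
`h(t, x+y) + h(t, x-y) - 2h(t,x) ≤ K y²`. Proof: `tripling_estimate` with the semiconcavity
modulus `y²/(θ(t - t_b))` and parameters `ε, σ, κ → 0`. (Semiconcavity of viscosity solutions
for convex Hamiltonians: P.-L. Lions, *Generalized solutions of Hamilton–Jacobi equations*, 1982,
§9–10; used in De Lellis–Otto–Westdickenberg 2004, proof of Cor. 2.5.) [folklore] -/
theorem semiconcave_of_viscosity {h : ℝ × ℝ → ℝ} {f : ℝ → ℝ} {Λ θ : ℝ}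
    (hcont : Continuous h) (hLipx : ∀ t x x', |h (t, x) - h (t, x')| ≤ Λ * |x - x'|)
    (hLipt : ∀ t t' x, |h (t, x) - h (t', x)| ≤ Λ * |t - t'|) (hΛ : 0 ≤ Λ) (hθ : 0 < θ)
    (hconv : ∀ e P, 2 * f e + θ * P ^ 2 ≤ f (e + P) + f (e - P))
    (hfL : ∀ B : ℝ, ∃ Lf, 0 ≤ Lf ∧ ∀ p p', |p| ≤ B → |p'| ≤ B → |f p - f p'| ≤ Lf * |p - p'|)
    {V : Set (ℝ × ℝ)}
    (hsub : ∀ z ∈ V, ∀ ζ : ℝ × ℝ → ℝ, ContDiffAt ℝ 1 ζ z → IsLocalMax (fun y => h y - ζ y) z →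
      fderiv ℝ ζ z (1, 0) + f (fderiv ℝ ζ z (0, 1)) ≤ 0)
    (hsup : ∀ z ∈ V, ∀ ζ : ℝ × ℝ → ℝ, ContDiffAt ℝ 1 ζ z → IsLocalMin (fun y => h y - ζ y) z →
      0 ≤ fderiv ℝ ζ z (1, 0) + f (fderiv ℝ ζ z (0, 1)))
    {tc xc ρ₀ : ℝ} (hρ₀ : 0 < ρ₀)
    (hbox : Icc (tc - ρ₀) (tc + ρ₀) ×ˢ Icc (xc - ρ₀) (xc + ρ₀) ⊆ V) :
    ∃ K r₀ : ℝ, 0 < r₀ ∧ ∀ t x y, |t - tc| < r₀ → |x - xc| < r₀ → |y| < r₀ →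
      h (t, x + y) + h (t, x - y) - 2 * h (t, x) ≤ K * y ^ 2 := by
  -- size of `h` on the box
  obtain ⟨Hsup, hHsup0, hHsup⟩ : ∃ Hsup, 0 ≤ Hsup ∧ ∀ t ∈ Icc (tc - ρ₀) (tc + ρ₀),
      ∀ x ∈ Icc (xc - ρ₀) (xc + ρ₀), |h (t, x)| ≤ Hsup := by
    refine ⟨|h (tc, xc)| + Λ * ρ₀ + Λ * ρ₀, by positivity, fun t ht x hx => ?_⟩
    have h1 := hLipt t tc x
    have h2 := hLipx tc x xc
    have h3 : |t - tc| ≤ ρ₀ := abs_le.mpr ⟨by linarith [ht.1], by linarith [ht.2]⟩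
    have h4 : |x - xc| ≤ ρ₀ := abs_le.mpr ⟨by linarith [hx.1], by linarith [hx.2]⟩
    have h5 : |h (t, x)| ≤ |h (t, x) - h (tc, x)| + |h (tc, x) - h (tc, xc)| + |h (tc, xc)| := by
      have e : h (t, x) = (h (t, x) - h (tc, x)) + ((h (tc, x) - h (tc, xc)) + h (tc, xc)) := by ring
      calc |h (t, x)| = |(h (t, x) - h (tc, x)) + ((h (tc, x) - h (tc, xc)) + h (tc, xc))| :=
            congrArg abs e
        _ ≤ |h (t, x) - h (tc, x)| + |(h (tc, x) - h (tc, xc)) + h (tc, xc)| := abs_add_le _ _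
        _ ≤ |h (t, x) - h (tc, x)| + (|h (tc, x) - h (tc, xc)| + |h (tc, xc)|) := by
            gcongr; exact abs_add_le _ _
        _ = _ := by ring
    nlinarith [mul_le_mul_of_nonneg_left h3 hΛ, mul_le_mul_of_nonneg_left h4 hΛ]
  -- the barrier profile and the speeds
  obtain ⟨g, hgs, hg0, hgH, hgnn, -, hg'nn, Γ, hΓ0, hg'Γ⟩ :=
    exists_barrier_profile (H := 8 * Hsup + 1) (R := ρ₀) (by positivity) hρ₀
  obtain ⟨Lf, hLf0, hfL'⟩ := hfL (Λ + Γ)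
  set L' : ℝ := Lf + 1 with hL'
  have hL'0 : 0 < L' := by positivity
  -- the time window
  set τ₀ : ℝ := min ρ₀ (ρ₀ / (8 * L')) with hτ₀
  have hτ₀0 : 0 < τ₀ := by positivity
  have hτ₀ρ : τ₀ ≤ ρ₀ := min_le_left _ _
  have hspeed : L' * ((tc + τ₀) - (tc - τ₀)) ≤ ρ₀ / 4 := by
    have : τ₀ ≤ ρ₀ / (8 * L') := min_le_right _ _
    rw [le_div_iff₀ (by positivity)] at this
    linarith
  have hbox' : Icc (tc - τ₀) (tc + τ₀) ×ˢ Icc (xc - ρ₀) (xc + ρ₀) ⊆ V := by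
    refine subset_trans ?_ hbox
    exact prod_mono (Icc_subset_Icc (by linarith) (by linarith)) le_rfl
  have hHsup' : ∀ t ∈ Icc (tc - τ₀) (tc + τ₀), ∀ x ∈ Icc (xc - ρ₀) (xc + ρ₀), |h (t, x)| ≤ Hsup :=
    fun t ht x hx => hHsup t ⟨by linarith [ht.1], by linarith [ht.2]⟩ x hx
  -- the claim with the sharp modulus
  have claim : ∀ th xh yh, tc - τ₀ < th → th < tc + τ₀ → |xh - xc| + |yh| ≤ ρ₀ / 4 →
      h (th, xh + yh) + h (th, xh - yh) - 2 * h (th, xh) ≤ yh ^ 2 / (θ * (th - (tc - τ₀))) := by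
    intro th xh yh hth1 hth2 hxy
    apply le_of_forall_pos_le_add
    intro η hη
    -- parameters
    have hgap1 : 0 < th - (tc - τ₀) := by linarith
    have hgap2 : 0 < tc + τ₀ - th := by linarith
    set κ : ℝ := min ((th - (tc - τ₀)) / 2) (η / (3 * (Λ ^ 2 * θ + 1))) with hκ
    have hκ0 : 0 < κ := by positivity
    set σ : ℝ := η * (tc + τ₀ - th) / 12 with hσ
    have hσ0 : 0 < σ := by positivity
    set κσ : ℝ := min ((tc + τ₀ - th) / 2) (σ / (4 * Hsup + 1)) with hκσ
    have hκσ0 : 0 < κσ := by positivity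
    set ε : ℝ := min (κ ^ 2 / (4 * Hsup + 2)) (η / (3 * (Λ ^ 2 + 1))) with hε
    have hε0 : 0 < ε := by positivity
    have hκσ' : κσ * (4 * Hsup + 1) ≤ σ := by
      have : κσ ≤ σ / (4 * Hsup + 1) := min_le_right _ _
      rwa [le_div_iff₀ (by positivity)] at this
    have hεκ : ε * (4 * Hsup + 2) ≤ κ ^ 2 := by
      have : ε ≤ κ ^ 2 / (4 * Hsup + 2) := min_le_left _ _
      rwa [le_div_iff₀ (by positivity)] at this
    have hth1' : tc - τ₀ + κ ≤ th := by
      have : κ ≤ (th - (tc - τ₀)) / 2 := min_le_left _ _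
      linarith
    have hth2' : th ≤ tc + τ₀ - κσ := by
      have : κσ ≤ (tc + τ₀ - th) / 2 := min_le_left _ _
      linarith
    have est := tripling_estimate (t_b := tc - τ₀) (t_e := tc + τ₀) hcont hLipx hLipt hΛ hθ hconv
      hfL' (by linarith) hL'0 hsub hsup hρ₀ hbox' hHsup' hHsup0 hgs hg0 hgH hgnn hg'nn hg'Γ hspeed
      hε0 hσ0 hκ0 hκσ0 hκσ' hεκ hth1' hth2' hxy
    -- the three error terms are each at most `η/3`
    have e1 : 3 * Λ ^ 2 * ε / 4 ≤ η / 3 := by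
      have h1 : ε ≤ η / (3 * (Λ ^ 2 + 1)) := min_le_right _ _
      rw [le_div_iff₀ (by positivity)] at h1
      nlinarith [sq_nonneg Λ, hε0.le]
    have e2 : Λ ^ 2 * θ * κ ≤ η / 3 := by
      have h1 : κ ≤ η / (3 * (Λ ^ 2 * θ + 1)) := min_le_right _ _
      rw [le_div_iff₀ (by positivity)] at h1
      nlinarith [mul_nonneg (sq_nonneg Λ) hθ.le, hκ0.le]
    have e3 : 4 * σ / (tc + τ₀ - th) = η / 3 := by
      rw [hσ]; field_simp; ring
    linarith
  -- conclusion
  refine ⟨2 / (θ * τ₀), min (τ₀ / 2) (ρ₀ / 8), by positivity, fun t x y ht hx hy => ?_⟩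
  have ht' : |t - tc| < τ₀ / 2 := lt_of_lt_of_le ht (min_le_left _ _)
  have hx' : |x - xc| < ρ₀ / 8 := lt_of_lt_of_le hx (min_le_right _ _)
  have hy' : |y| < ρ₀ / 8 := lt_of_lt_of_le hy (min_le_right _ _)
  have ht1 : tc - τ₀ < t := by linarith [(abs_lt.mp ht').1]
  have ht2 : t < tc + τ₀ := by linarith [(abs_lt.mp ht').2]
  have hgap : τ₀ / 2 ≤ t - (tc - τ₀) := by linarith [(abs_lt.mp ht').1]
  have := claim t x y ht1 ht2 (by linarith)
  refine this.trans ?_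
  rw [div_le_iff₀ (by positivity)]
  have : y ^ 2 * (τ₀ / 2) ≤ y ^ 2 * (t - (tc - τ₀)) := mul_le_mul_of_nonneg_left hgap (sq_nonneg y)
  have e : 2 / (θ * τ₀) * y ^ 2 * (θ * (t - (tc - τ₀))) = (2 / τ₀) * (y ^ 2 * (t - (tc - τ₀))) := by
    field_simp
  rw [e, div_mul_eq_mul_div, le_div_iff₀ hτ₀0]
  nlinarith




end Literature.Analysis.PDE.SingleEntropy
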